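import Summits.HubbardSuperconductivity.HubbardSuperconductivity.Theorems.NodalDiracTwistTwistCalibrationBdGHolonomyCharts

/-!
# Route `NodalDiracTwist` — support `TwistCalibrationBdG`: the mesh lemmas (holonomy, part 2)

Discrete holonomy of the square-root bundle along a closed curve, for stmt-HubbardSuperconductivity-1625.
For a continuous, `2π`-periodic, nonvanishing curve `z : ℝ → ℂ` sampled at the `n`-th roots of unity
angles `θ_i = 2πi/n` (successor `finRotate`):
* `exists_mesh_prod_pos` — if ONE square-root branch is continuous along the whole curve (the curve
  avoids a ray), then for all fine meshes some choice of square roots `s_i² = z(θ_i)` has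
  `Π_i Re(conj s_i · s_{i+1}) > 0` (trivial holonomy);
* `exists_mesh_prod_neg` — if the curve crosses the cut line transversally as in `exists_sqrt_charts`
  (avoiding `ℝ≥0·(-d)` on `[-π/3, 4π/3]`, `ℝ≥0·d` on `[2π/3, 7π/3]`, opposite half-planes near `0` and
  `π`), then for all fine meshes some choice of roots has `Π_i Re(conj s_i · s_{i+1}) < 0`
  (holonomy `-1`: the curve winds once around `0`).
Uniform continuity on compact arcs (`exists_mesh_re_conj_mul_pos`) supplies the mesh.

Sources: Fukui–Hatsugai–Suzuki, J. Phys. Soc. Jpn. 74 (2005) 1674 (lattice link variables); folklore.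
No definitions.
-/

-- the mandated namespace `Summit.<Summit>.<Problem>.Theorems` repeats `HubbardSuperconductivity`
-- (single-problem summit, D-0017), which the `dupNamespace` linter flags on every declaration
set_option linter.dupNamespace false

namespace Summit.HubbardSuperconductivity.HubbardSuperconductivity.Theorems.NodalDiracTwist

open Complex Set Filter Topology
open scoped ComplexConjugate

/-! ### The mesh lemmas -/

/-- Angles of the rotated index: `z(2π σ(i)/n) = z(2π (i+1)/n)` for a `2π`-periodic `z`. [folklore] -/
theorem apply_finRotate_angle {z : ℝ → ℂ} (hper : ∀ θ, z (θ + 2 * Real.pi) = z θ) {n : ℕ} (i : Fin n) :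
    z (2 * Real.pi * ((finRotate n i : ℕ) : ℝ) / n) = z (2 * Real.pi * ((i : ℕ) + 1 : ℝ) / n) := by
  cases n with
  | zero => exact i.elim0
  | succ m =>
    by_cases hi : i = Fin.last m
    · subst hi
      rw [finRotate_last, Fin.val_zero, Fin.val_last, Nat.cast_zero, mul_zero, zero_div]
      have : (2 * Real.pi * ((m : ℕ) + 1 : ℝ) / (m + 1 : ℕ) : ℝ) = 0 + 2 * Real.pi := by
        rw [zero_add]; push_cast; field_simp
      rw [this, hper]
    · rw [coe_finRotate_of_ne_last hi, Nat.cast_add, Nat.cast_one]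

/-- The uniform-continuity step: for a continuous nonvanishing `F` there are `m > 0` (a lower bound
of `|F|` on `K`) and a mesh `n₀` such that points of `K` at distance `≤ 2π/n`, `n ≥ n₀`, have
`Re(conj F(a) F(b)) > 0`. [folklore] -/
theorem exists_mesh_re_conj_mul_pos {F : ℝ → ℂ} {K : Set ℝ} (hK : IsCompact K)
    (hF : ContinuousOn F K) (hF0 : ∀ θ ∈ K, F θ ≠ 0) :
    ∃ n₀ : ℕ, ∀ n ≥ n₀, ∀ a ∈ K, ∀ b ∈ K, |a - b| ≤ 2 * Real.pi / n →
      0 < ((starRingEnd ℂ) (F a) * F b).re := by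
  obtain ⟨m, hm0, hm⟩ : ∃ m, 0 < m ∧ ∀ θ ∈ K, m ≤ ‖F θ‖ :=
    hK.exists_forall_le' (continuous_norm.comp_continuousOn hF) (fun θ hθ => norm_pos_iff.2 (hF0 θ hθ))
  obtain ⟨δ, hδ0, hδ⟩ := Metric.uniformContinuousOn_iff.1 (hK.uniformContinuousOn_of_continuous hF) m hm0
  obtain ⟨N, hN⟩ := exists_nat_gt (2 * Real.pi / δ)
  refine ⟨N + 1, fun n hn a ha b hb hab => ?_⟩
  have hn0 : (0 : ℝ) < n := by exact_mod_cast (by omega : 0 < n)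
  have hNn : (N : ℝ) + 1 ≤ n := by exact_mod_cast hn
  have h2 : 2 * Real.pi / n < δ := by
    rw [div_lt_iff₀ hn0]
    rw [div_lt_iff₀ hδ0] at hN
    nlinarith
  have h1 := hδ a ha b hb (by rw [Real.dist_eq]; linarith)
  rw [dist_eq_norm] at h1
  exact re_conj_mul_pos_of_norm_sub_lt (h1.trans_le (hm a ha))

/-- **Mesh lemma, regular block.** Let `z` be continuous, `2π`-periodic and nonvanishing, and let `c`
be a square-root branch continuous at every point of the curve. Then for all fine meshes the cyclic
overlap product of the roots `c(z(2πi/n))` is positive. [folklore] -/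
theorem exists_mesh_prod_pos {z : ℝ → ℂ} (hz : Continuous z) (hper : ∀ θ, z (θ + 2 * Real.pi) = z θ)
    (hz0 : ∀ θ, z θ ≠ 0) {c : ℂ → ℂ} (hcsq : ∀ w, c w ^ 2 = w) (hc : ∀ θ, ContinuousAt c (z θ)) :
    ∃ n₀ : ℕ, ∀ n ≥ n₀, ∃ s : Fin n → ℂ, (∀ i, s i ^ 2 = z (2 * Real.pi * (i : ℕ) / n)) ∧
      0 < ∏ i, ((starRingEnd ℂ) (s i) * s (finRotate n i)).re := by
  set F : ℝ → ℂ := fun θ => c (z θ) with hFdef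
  have hF : Continuous F := continuous_iff_continuousAt.2 fun θ => (hc θ).comp hz.continuousAt
  have hF0 : ∀ θ, F θ ≠ 0 := fun θ h0 => hz0 θ (by rw [← hcsq (z θ)]; change F θ ^ 2 = 0; rw [h0]; ring)
  obtain ⟨n₀, hn₀⟩ := exists_mesh_re_conj_mul_pos (K := Set.Icc (-1) (4 * Real.pi)) isCompact_Icc
    hF.continuousOn (fun θ _ => hF0 θ)
  refine ⟨n₀ + 1, fun n hn => ⟨fun i => F (2 * Real.pi * (i : ℕ) / n), fun i => hcsq _, ?_⟩⟩
  have hn0 : (0 : ℝ) < n := by exact_mod_cast (by omega : 0 < n)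
  refine Finset.prod_pos fun i _ => ?_
  have hrot : F (2 * Real.pi * ((finRotate n i : ℕ) : ℝ) / n) = F (2 * Real.pi * ((i : ℕ) + 1 : ℝ) / n) := by
    simp only [hFdef]; rw [apply_finRotate_angle hper]
  change 0 < ((starRingEnd ℂ) (F (2 * Real.pi * (i : ℕ) / n)) * F (2 * Real.pi * ((finRotate n i : ℕ) : ℝ) / n)).re
  rw [hrot]
  have hi : ((i : ℕ) : ℝ) + 1 ≤ n := by exact_mod_cast i.isLt
  have hpi := Real.pi_pos
  refine hn₀ n (by omega) _ ⟨?_, ?_⟩ _ ⟨?_, ?_⟩ ?_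
  · have : (0 : ℝ) ≤ 2 * Real.pi * (i : ℕ) / n := by positivity
    linarith
  · rw [div_le_iff₀ hn0]; nlinarith
  · have : (0 : ℝ) ≤ 2 * Real.pi * ((i : ℕ) + 1) / n := by positivity
    linarith
  · rw [div_le_iff₀ hn0]; nlinarith
  · rw [abs_sub_comm, abs_of_nonneg] <;> [apply le_of_eq; skip]
    · field_simp; ring
    · rw [sub_nonneg, div_le_div_iff_of_pos_right hn0]; nlinarith

/-- **Mesh lemma, nodal block.** Let `z` be continuous, `2π`-periodic and nonvanishing; let `d` be a
unit vector with square-root charts `c₁` (continuous off `ℝ≥0·(-d)`), `c₂` (continuous off `ℝ≥0·d`)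
related by `c₂ = ε₁ c₁` on `Im(w conj d) > 0`, `c₂ = ε₂ c₁` on `Im(w conj d) < 0`, `ε₁ε₂ = -1`.
Suppose the curve avoids `ℝ≥0·(-d)` on `[-π/3, 4π/3]` and `ℝ≥0·d` on `[2π/3, 7π/3]`, and lies in
opposite open half-planes near `θ = 0` and `θ = π`. Then for fine meshes the cyclic overlap product of
the roots `c₁(z(2πi/n))` (`2i ≤ n`), `c₂(z(2πi/n))` (`2i > n`) is NEGATIVE: the holonomy of the
square-root (Möbius) bundle around the winding curve is `-1`. [folklore] -/
theorem exists_mesh_prod_neg {z : ℝ → ℂ} (hz : Continuous z) (hper : ∀ θ, z (θ + 2 * Real.pi) = z θ)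
    (hz0 : ∀ θ, z θ ≠ 0) {d : ℂ} {c₁ c₂ : ℂ → ℂ} (h1sq : ∀ w, c₁ w ^ 2 = w) (h2sq : ∀ w, c₂ w ^ 2 = w)
    (h1c : ∀ w, (¬ ∃ t : ℝ, 0 ≤ t ∧ w = t * (-d)) → ContinuousAt c₁ w)
    (h2c : ∀ w, (¬ ∃ t : ℝ, 0 ≤ t ∧ w = t * d) → ContinuousAt c₂ w)
    {ε₁ ε₂ : ℂ} (hε : ε₁ * ε₂ = -1)
    (hP₁ : ∀ w, 0 < (w * (starRingEnd ℂ) d).im → c₂ w = ε₁ * c₁ w)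
    (hP₂ : ∀ w, (w * (starRingEnd ℂ) d).im < 0 → c₂ w = ε₂ * c₁ w)
    (hR₂ : ∀ θ ∈ Set.Icc (-(Real.pi / 3)) (4 * Real.pi / 3), ¬ ∃ t : ℝ, 0 ≤ t ∧ z θ = t * (-d))
    (hR₁ : ∀ θ ∈ Set.Icc (2 * Real.pi / 3) (7 * Real.pi / 3), ¬ ∃ t : ℝ, 0 ≤ t ∧ z θ = t * d)
    {σ : ℝ} (hσ : σ = 1 ∨ σ = -1)
    (hH0 : ∀ θ ∈ Set.Ioo (-(Real.pi / 3)) (Real.pi / 3), 0 < σ * (z θ * (starRingEnd ℂ) d).im)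
    (hHπ : ∀ θ ∈ Set.Ioo (2 * Real.pi / 3) (4 * Real.pi / 3), σ * (z θ * (starRingEnd ℂ) d).im < 0) :
    ∃ n₀ : ℕ, ∀ n ≥ n₀, ∃ s : Fin n → ℂ, (∀ i, s i ^ 2 = z (2 * Real.pi * (i : ℕ) / n)) ∧
      ∏ i, ((starRingEnd ℂ) (s i) * s (finRotate n i)).re < 0 := by
  have hpi := Real.pi_pos
  -- the two continuous lifts on the two arcs
  set K₁ : Set ℝ := Set.Icc (-(Real.pi / 3)) (4 * Real.pi / 3) with hK₁
  set K₂ : Set ℝ := Set.Icc (2 * Real.pi / 3) (7 * Real.pi / 3) with hK₂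
  set F₁ : ℝ → ℂ := fun θ => c₁ (z θ) with hF₁def
  set F₂ : ℝ → ℂ := fun θ => c₂ (z θ) with hF₂def
  have hF₁ : ContinuousOn F₁ K₁ := fun θ hθ =>
    ((h1c _ (hR₂ θ hθ)).comp hz.continuousAt).continuousWithinAt
  have hF₂ : ContinuousOn F₂ K₂ := fun θ hθ =>
    ((h2c _ (hR₁ θ hθ)).comp hz.continuousAt).continuousWithinAt
  have hF₁0 : ∀ θ, F₁ θ ≠ 0 := fun θ h0 => hz0 θ (by rw [← h1sq (z θ)]; change F₁ θ ^ 2 = 0; rw [h0]; ring)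
  have hF₂0 : ∀ θ, F₂ θ ≠ 0 := fun θ h0 => hz0 θ (by rw [← h2sq (z θ)]; change F₂ θ ^ 2 = 0; rw [h0]; ring)
  obtain ⟨n₁, hn₁⟩ := exists_mesh_re_conj_mul_pos isCompact_Icc hF₁ (fun θ _ => hF₁0 θ)
  obtain ⟨n₂, hn₂⟩ := exists_mesh_re_conj_mul_pos isCompact_Icc hF₂ (fun θ _ => hF₂0 θ)
  -- the transition signs near `θ = π` and `θ = 0`
  obtain ⟨η₀, ηπ, hη, hη0, hηπ⟩ : ∃ η₀ ηπ : ℂ, η₀ * ηπ = -1 ∧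
      (∀ θ ∈ Set.Ioo (-(Real.pi / 3)) (Real.pi / 3), c₂ (z θ) = η₀ * c₁ (z θ)) ∧
      (∀ θ ∈ Set.Ioo (2 * Real.pi / 3) (4 * Real.pi / 3), c₂ (z θ) = ηπ * c₁ (z θ)) := by
    rcases hσ with rfl | rfl
    · refine ⟨ε₁, ε₂, hε, fun θ hθ => hP₁ _ ?_, fun θ hθ => hP₂ _ ?_⟩
      · have := hH0 θ hθ; rwa [one_mul] at this
      · have := hHπ θ hθ; rwa [one_mul] at this
    · refine ⟨ε₂, ε₁, by rw [mul_comm, hε], fun θ hθ => hP₂ _ ?_, fun θ hθ => hP₁ _ ?_⟩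
      · have := hH0 θ hθ; rw [neg_one_mul] at this; linarith
      · have := hHπ θ hθ; rw [neg_one_mul] at this; linarith
  -- the transition signs are `±1` (compare squares at `θ = 0`, `θ = π`)
  have sign_of : ∀ (η : ℂ) (t : ℝ), c₂ (z t) = η * c₁ (z t) → (η = 1 ∨ η = -1) := by
    intro η t ht
    have h1 : η ^ 2 * z t = z t := by
      calc η ^ 2 * z t = (η * c₁ (z t)) ^ 2 := by rw [mul_pow, h1sq]
        _ = z t := by rw [← ht, h2sq]
    have h2 : η ^ 2 = 1 := by
      have := mul_right_cancel₀ (hz0 t) (h1.trans (one_mul _).symm)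
      exact this
    have h2' : η * η = 1 := by rw [← sq]; exact h2
    exact mul_self_eq_one_iff.mp h2'
  have h0mem : (0 : ℝ) ∈ Set.Ioo (-(Real.pi / 3)) (Real.pi / 3) := ⟨by linarith, by linarith⟩
  have hπmem : Real.pi ∈ Set.Ioo (2 * Real.pi / 3) (4 * Real.pi / 3) := ⟨by linarith, by linarith⟩
  obtain ⟨r₀, hr₀, hr₀'⟩ : ∃ r₀ : ℝ, (r₀ = 1 ∨ r₀ = -1) ∧ η₀ = r₀ := by
    rcases sign_of η₀ 0 (hη0 0 h0mem) with h | h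
    · exact ⟨1, Or.inl rfl, by rw [h]; simp⟩
    · exact ⟨-1, Or.inr rfl, by rw [h]; simp⟩
  obtain ⟨rπ, hrπ, hrπ'⟩ : ∃ rπ : ℝ, (rπ = 1 ∨ rπ = -1) ∧ ηπ = rπ := by
    rcases sign_of ηπ Real.pi (hηπ Real.pi hπmem) with h | h
    · exact ⟨1, Or.inl rfl, by rw [h]; simp⟩
    · exact ⟨-1, Or.inr rfl, by rw [h]; simp⟩
  have hrr : r₀ * rπ = -1 := by
    have := hη; rw [hr₀', hrπ'] at this; exact_mod_cast this
  refine ⟨max n₁ n₂ + 7, fun n hn => ?_⟩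
  have hn1 : n₁ ≤ n := by omega
  have hn2 : n₂ ≤ n := by omega
  have hn7 : 7 ≤ n := by omega
  have hn0 : (0 : ℝ) < n := by exact_mod_cast (by omega : 0 < n)
  have hn7' : (7 : ℝ) ≤ n := by exact_mod_cast hn7
  have hmesh : 2 * Real.pi / n < Real.pi / 3 := by
    rw [div_lt_div_iff₀ hn0 (by norm_num : (0:ℝ) < 3)]; nlinarith
  have hpos : 0 < 2 * Real.pi / n := div_pos (mul_pos two_pos hpi) hn0
  -- the roots
  set θ : Fin n → ℝ := fun i => 2 * Real.pi * (i : ℕ) / n with hθ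
  set s : Fin n → ℂ := fun i => if 2 * (i : ℕ) ≤ n then F₁ (θ i) else F₂ (θ i) with hs
  refine ⟨s, fun i => ?_, ?_⟩
  · simp only [hs]; split_ifs
    · exact h1sq _
    · exact h2sq _
  -- the correcting signs
  set e : Fin n → ℝ := fun i => if (i : ℕ) + 1 = n then r₀ else
    if 2 * (i : ℕ) ≤ n ∧ ¬ 2 * ((i : ℕ) + 1) ≤ n then rπ else 1 with he
  have he1 : ∀ i, e i * e i = 1 := by
    intro i; simp only [he]
    split_ifs
    · rcases hr₀ with h | h <;> rw [h] <;> norm_num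
    · rcases hrπ with h | h <;> rw [h] <;> norm_num
    · norm_num
  -- angles
  have hθi : ∀ i : Fin n, θ i = 2 * Real.pi * (i : ℕ) / n := fun i => rfl
  have hθ_nonneg : ∀ i : Fin n, 0 ≤ θ i := fun i => by rw [hθi]; positivity
  have hθ_lt : ∀ i : Fin n, θ i < 2 * Real.pi := fun i => by
    rw [hθi, div_lt_iff₀ hn0]
    have : ((i : ℕ) : ℝ) < n := by exact_mod_cast i.isLt
    nlinarith
  have hθ_le_pi : ∀ i : Fin n, 2 * (i : ℕ) ≤ n → θ i ≤ Real.pi := fun i hi => by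
    rw [hθi, div_le_iff₀ hn0]
    have : (2 * (i : ℕ) : ℝ) ≤ n := by exact_mod_cast hi
    nlinarith
  have hθ_gt_pi : ∀ i : Fin n, ¬ 2 * (i : ℕ) ≤ n → Real.pi < θ i := fun i hi => by
    rw [hθi, lt_div_iff₀ hn0]
    have : (n : ℝ) < 2 * (i : ℕ) := by exact_mod_cast (not_le.mp hi)
    nlinarith
  -- each corrected factor is a positive overlap
  have key : ∀ i : Fin n, 0 < e i * ((starRingEnd ℂ) (s i) * s (finRotate n i)).re := by
    intro i
    by_cases hlast : (i : ℕ) + 1 = n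
    · -- case D: wrap-around
      have hj0 : ((finRotate n i : ℕ) : ℕ) = 0 := by
        cases n with
        | zero => exact absurd hlast (by omega)
        | succ m =>
          have : i = Fin.last m := Fin.ext (by rw [Fin.val_last]; omega)
          rw [coe_finRotate, if_pos this]
      have hi2 : ¬ 2 * (i : ℕ) ≤ n := by omega
      have hsi : s i = F₂ (θ i) := by simp only [hs]; rw [if_neg hi2]
      have hsj : s (finRotate n i) = F₁ 0 := by
        simp only [hs, hθ]
        rw [hj0, if_pos (by omega)]
        simp
      have hei : e i = r₀ := by simp only [he]; rw [if_pos hlast]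
      -- periodicity: `θ i = -2π/n + 2π`
      have hper' : z (θ i) = z (-(2 * Real.pi / n)) := by
        have : θ i = -(2 * Real.pi / n) + 2 * Real.pi := by
          rw [hθi]
          have : ((i : ℕ) : ℝ) = n - 1 := by
            have : ((i : ℕ) : ℝ) + 1 = n := by exact_mod_cast hlast
            linarith
          rw [this]; field_simp; ring
        rw [this, hper]
      have hmem : -(2 * Real.pi / n) ∈ Set.Ioo (-(Real.pi / 3)) (Real.pi / 3) :=
        ⟨by linarith, by linarith [div_pos (mul_pos two_pos hpi) hn0]⟩
      have hF2 : F₂ (θ i) = η₀ * F₁ (-(2 * Real.pi / n)) := by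
        change c₂ (z (θ i)) = η₀ * c₁ (z (-(2 * Real.pi / n)))
        rw [hper']; exact hη0 _ hmem
      rw [hsi, hsj, hei, hF2, hr₀', map_mul, Complex.conj_ofReal, mul_assoc, Complex.re_ofReal_mul,
        ← mul_assoc, show (r₀ * r₀ : ℝ) = 1 from ?_, one_mul]
      · refine hn₁ n hn1 (-(2 * Real.pi / n)) ⟨by linarith [hmem.1], by linarith [hmem.2]⟩ 0
          ⟨by linarith, by linarith⟩ ?_
        rw [sub_zero, abs_neg, abs_of_pos (div_pos (mul_pos two_pos hpi) hn0)]
      · rcases hr₀ with h | h <;> rw [h] <;> norm_num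
    · have hlt : (i : ℕ) + 1 < n := by omega
      have hj : ((finRotate n i : ℕ) : ℕ) = (i : ℕ) + 1 := by
        cases n with
        | zero => exact absurd hlt (by omega)
        | succ m =>
          have : i ≠ Fin.last m := fun h => by rw [h, Fin.val_last] at hlt; omega
          exact coe_finRotate_of_ne_last this
      have hθj : θ (finRotate n i) = θ i + 2 * Real.pi / n := by
        rw [hθi, hθi, hj]; push_cast; ring
      have hdist : |θ i - θ (finRotate n i)| ≤ 2 * Real.pi / n := by
        rw [hθj, show θ i - (θ i + 2 * Real.pi / n) = -(2 * Real.pi / n) by ring, abs_neg,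
          abs_of_pos (div_pos (mul_pos two_pos hpi) hn0)]
      by_cases hiU : 2 * (i : ℕ) ≤ n
      · by_cases hjU : 2 * ((i : ℕ) + 1) ≤ n
        · -- case A: both on the upper arc
          have hsi : s i = F₁ (θ i) := by simp only [hs]; rw [if_pos hiU]
          have hsj : s (finRotate n i) = F₁ (θ (finRotate n i)) := by
            simp only [hs]; rw [hj, if_pos hjU]
          have hei : e i = 1 := by simp only [he]; rw [if_neg hlast, if_neg (fun h => h.2 hjU)]
          rw [hsi, hsj, hei, one_mul]
          have hjU' : 2 * ((finRotate n i : ℕ) : ℕ) ≤ n := by rw [hj]; exact hjU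
          exact hn₁ n hn1 (θ i) ⟨by linarith [hθ_nonneg i], by linarith [hθ_le_pi i hiU]⟩ (θ (finRotate n i))
            ⟨by linarith [hθ_nonneg (finRotate n i)], by linarith [hθ_le_pi _ hjU']⟩ hdist
        · -- case B: the transition near `π`
          have hsi : s i = F₁ (θ i) := by simp only [hs]; rw [if_pos hiU]
          have hsj : s (finRotate n i) = F₂ (θ (finRotate n i)) := by
            simp only [hs]; rw [hj, if_neg hjU]
          have hei : e i = rπ := by simp only [he]; rw [if_neg hlast, if_pos ⟨hiU, hjU⟩]
          have hmem : θ (finRotate n i) ∈ Set.Ioo (2 * Real.pi / 3) (4 * Real.pi / 3) := by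
            have h1 : Real.pi < θ (finRotate n i) := hθ_gt_pi _ (by rw [hj]; exact hjU)
            refine ⟨by linarith, ?_⟩
            rw [hθj]; linarith [hθ_le_pi i hiU]
          have hF2 : F₂ (θ (finRotate n i)) = ηπ * F₁ (θ (finRotate n i)) := hηπ _ hmem
          rw [hsi, hsj, hei, hF2, hrπ', mul_left_comm, Complex.re_ofReal_mul, ← mul_assoc,
            show (rπ * rπ : ℝ) = 1 from ?_, one_mul]
          · exact hn₁ n hn1 (θ i) ⟨by linarith [hθ_nonneg i], by linarith [hθ_le_pi i hiU]⟩ (θ (finRotate n i))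
              ⟨by linarith [hmem.1], by linarith [hmem.2]⟩ hdist
          · rcases hrπ with h | h <;> rw [h] <;> norm_num
      · -- case C: both on the lower arc
        have hjU : ¬ 2 * ((i : ℕ) + 1) ≤ n := by omega
        have hsi : s i = F₂ (θ i) := by simp only [hs]; rw [if_neg hiU]
        have hsj : s (finRotate n i) = F₂ (θ (finRotate n i)) := by
          simp only [hs]; rw [hj, if_neg hjU]
        have hei : e i = 1 := by simp only [he]; rw [if_neg hlast, if_neg (fun h => hiU h.1)]
        rw [hsi, hsj, hei, one_mul]
        have h1 : Real.pi < θ i := hθ_gt_pi i hiU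
        have h2 : θ (finRotate n i) < 2 * Real.pi := hθ_lt _
        exact hn₂ n hn2 (θ i) ⟨by linarith, by linarith [hθ_lt i]⟩ (θ (finRotate n i))
          ⟨by rw [hθj]; linarith, by linarith⟩ hdist
  -- the product of the correcting signs is `-1`
  have hprod_e : ∏ i, e i = -1 := by
    have hD : (⟨n - 1, by omega⟩ : Fin n) ∈ Finset.univ := Finset.mem_univ _
    rw [← Finset.mul_prod_erase _ _ hD]
    have hB : (⟨n / 2, by omega⟩ : Fin n) ∈ Finset.univ.erase (⟨n - 1, by omega⟩ : Fin n) := by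
      rw [Finset.mem_erase]
      exact ⟨Fin.ne_of_val_ne (show n / 2 ≠ n - 1 by omega), Finset.mem_univ _⟩
    rw [← Finset.mul_prod_erase _ _ hB]
    have h1 : e ⟨n - 1, by omega⟩ = r₀ := by
      simp only [he]; rw [if_pos (by omega)]
    have h2 : e ⟨n / 2, by omega⟩ = rπ := by
      simp only [he]; rw [if_neg (by omega), if_pos (by omega)]
    have h3 : ∏ i ∈ (Finset.univ.erase (⟨n - 1, by omega⟩ : Fin n)).erase ⟨n / 2, by omega⟩, e i = 1 := by
      refine Finset.prod_eq_one fun i hi => ?_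
      rw [Finset.mem_erase, Finset.mem_erase] at hi
      have hi1 : (i : ℕ) ≠ n / 2 := fun h => hi.1 (Fin.ext h)
      have hi2 : (i : ℕ) ≠ n - 1 := fun h => hi.2.1 (Fin.ext h)
      simp only [he]
      rw [if_neg (by omega), if_neg (by omega)]
    rw [h1, h2, h3, mul_one, hrr]
  -- assemble
  have hsplit : ∏ i, ((starRingEnd ℂ) (s i) * s (finRotate n i)).re =
      (∏ i, e i) * ∏ i, (e i * ((starRingEnd ℂ) (s i) * s (finRotate n i)).re) := by
    rw [← Finset.prod_mul_distrib]
    refine Finset.prod_congr rfl fun i _ => ?_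
    rw [← mul_assoc, he1, one_mul]
  rw [hsplit, hprod_e, neg_one_mul, neg_lt_zero]
  exact Finset.prod_pos fun i _ => key i

end Summit.HubbardSuperconductivity.HubbardSuperconductivity.Theorems.NodalDiracTwist
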